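import Literature.AnabelianGeometry.EtaleTheta.Discharge.Sec2Cor219iiiInnerAut
import HarnessLib

/-!
# [EtTh] Cor. 2.19 (iii), tower form (`ThetaEnvTower.Cor219_iii`, F-0650) — transport toolkit, part 2a (GENERIC):
# pinning / equivariance of the coefficient automorphisms `γ̄_M`, and the inflation step «a mod-`M` cocycle on
# `Π^tp_Ÿ̲̲` vanishing on `Δ` IS a continuous `G_K`-cocycle through `aug`» (proof-only)

S. Mochizuki, *The étale theta function and its Frobenioid-theoretic manifestations*, Publ. RIMS **45** (2009)
[EtTh], §2, Cor. 2.19 (iii), PRIMS PDF p. 65 ("up to … some multiple of the collection of classes by [a `(K^×)^∧`-multiple]");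
Cor. 2.18 (i) p. 60 (the subquotient `(l·Δ_Θ)` is preserved); Prop. 2.2 (iii) p. 37 ("`G_K ≅ Π_X̲̲/Δ_X̲̲`")
[cite: MochizukiEtTh2009, Cor 2.19(iii) p.65].

Cell `abc-iut`, seat abc-iut-w4-d038 (gen 9), K-L6 / C-R33 row «COR219III-AT-MODELTATE», PART 2a — items G1/G1′/G7 of the
row's roadmap (HOME/staging/L6/w4-d038/g9/COR219III-PART2-ROADMAP.md), GENERIC over every §1 setting `D`, every `E`,
every `X̲̲ = C`, every cyclotome tower `τ`.  PROOF-ONLY: no definition, no instance, no notation, no new named fact;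
abc-iut-L2-t8's `TowerOfSetting` / `ThetaSectionsOfSetting` (`lift`, `aug_lift`), abc-iut-L2-t2's `ThetaSystems`,
abc-iut-L2-t1's `CyclotomeMod.red_conj` consumed BY NAME; sequel of this seat's `Sec2Cor219iiiInnerAut` (p467752).

WHAT IS SHOWN, for the §1-instantiated tower `T := C.thetaEnvTower τ hC hS`:
* `thetaEnvTower_thetaMod_conj` — `thetaMod_M (k g k⁻¹) = χ(aug k) · thetaMod_M g` (`k ∈ Π^tp_X̲̲`, `g` in the inverse image of
  `l·Δ_Θ`): the `G_K`-equivariance of `(l·Δ_Θ) ↠ μ_M` in tower currency;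
* `thetaEnvTower_coeffAut_apply` / `_unique` (G1) — if `γ` maps the inverse image of `l·Δ_Θ` into itself (clause (5) of
  Cor. 2.18 (i)), a coefficient automorphism `γ̄_M` admitted by the compatibility hypothesis of `ThetaEnvTower.Cor219_iii` is
  PINNED: `γ̄_M (thetaMod_M g) = thetaMod_M (γ g)` for ALL `g`, and any two admitted `γ̄_M` coincide;
* `thetaEnvTower_coeffAut_equivariant` (G1′) — hence `γ̄_M (χ(aug k) · m) = χ(aug (γ k)) · γ̄_M m`: the ONLY equivariance the
  transport argument needs (no identity `χ ∘ aug ∘ γ = χ ∘ aug` is required);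
* `exists_envCocycle_of_vanishing` (G7) — a locally constant `μ_M`-valued function `q` on `Π^tp_Ÿ̲̲` satisfying the mod-`M`
  cocycle law and vanishing on `Π^tp_Ÿ̲̲ ∩ Ker(aug)` IS `c ∘ aug` for a `G_K`-cocycle `c` (`CycEnvelope.IsEnvCocycle`), with
  `c ∘ aug` locally constant on `Π^tp_X̲̲` as soon as `aug|_{Π^tp_Ÿ̲̲}` is an open map (true at the models of record) — the shape
  of the family `c = (c_M)_M` that `ThetaEnvTower.Cor219_iii` asks for ("`G_K ≅ Π_X̲̲/Δ_X̲̲`", `map_aug_Ydduu`).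

v2 (append-only, §3 = roadmap G2/G2′): `toLDelta_eq_one_iff`, `exists_lDeltaAut` — an automorphism
`γ` of `Π^tp_X̲̲` preserving `Ker(Π^tp_X̲̲ → (Π^tp_X)^Θ)` and the inverse image of `l·Δ_Θ` (clauses (4), (5) of Cor. 2.18 (i))
INDUCES an automorphism `γ̃` of `l·Δ_Θ` itself (`θ(γ g) = γ̃(θ g)`; the `l·Δ_Θ`-level twin of abc-iut-L2-d1's
`RigidData.exists_mulEquiv_thetaMod_comp`), and `lDeltaAut_conj` — `γ̃` intertwines the conjugation actions through `γ`.

HONEST FRAMING: unconditional statements about OUR typed objects over an arbitrary §1 setting; nothing of [EtTh] (refereed)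
is asserted beyond what is proved; no side is taken on [IUTchIII] Cor. 3.12; typed ≠ proved; nothing asserts abc proved or
refuted.
-/

noncomputable section

namespace Literature.AnabelianGeometry.EtaleTheta

open Literature.AnabelianGeometry.SemiGraphs

namespace ThetaSetting.EtaleThetaData.DoubleUnderline

variable {p : ℕ} [Fact p.Prime] {D : ThetaSetting p} {E : D.EtaleThetaData} {l : ℕ}
  (C : E.DoubleUnderline l) {Es : Set ℕ+} (τ : D.CyclotomeTower l Es)

/-! ## §1. Pinning and equivariance of the coefficient automorphisms (roadmap G1, G1′) -/

/-- **`(l·Δ_Θ) ↠ μ_M` is `G_K`-equivariant, tower currency**: `thetaMod_M (k g k⁻¹) = χ(aug k) · thetaMod_M g` for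
`k ∈ Π^tp_X̲̲` and `g` in the inverse image of `l·Δ_Θ` (abc-iut-L2-t1's `CyclotomeMod.red_conj`).
[cite: MochizukiEtTh2009, Def 2.13 p.46] -/
theorem thetaEnvTower_thetaMod_conj (hC : D.Compat) (hS : D.Sec2Hyps) (M : Es)
    (k : (C.thetaEnvTower τ hC hS).PiX) (g : (C.thetaEnvTower τ hC hS).lDeltaTheta)
    (hkg : k * (g : (C.thetaEnvTower τ hC hS).PiX) * k⁻¹ ∈ (C.thetaEnvTower τ hC hS).lDeltaTheta) :
    (C.thetaEnvTower τ hC hS).thetaMod M ⟨k * g * k⁻¹, hkg⟩ =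
      galMuN p M (D.aug.toMonoidHom (k : D.PiTemp)) ((C.thetaEnvTower τ hC hS).thetaMod M g) := by
  change (τ.mod M).red (C.toLDelta ⟨k * g * k⁻¹, hkg⟩) =
    galMuN p M (D.aug.toMonoidHom (k : D.PiTemp)) ((τ.mod M).red (C.toLDelta g))
  rw [← (τ.mod M).red_conj]
  congr 1
  apply Subtype.ext
  simp only [coe_toLDelta, Subgroup.coe_mul, Subgroup.coe_inv, map_mul, map_inv]

/-- The inverse image of `l·Δ_Θ` in `Π^tp_X̲̲` is normal (it is the pull-back of the normal subgroup `l·Δ_Θ ⊴ (Π^tp_X)^Θ`).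
[cite: MochizukiEtTh2009, Prop 2.12 (i) p.45] -/
theorem thetaEnvTower_lDeltaTheta_normal (hC : D.Compat) (hS : D.Sec2Hyps) :
    (C.thetaEnvTower τ hC hS).lDeltaTheta.Normal :=
  (D.lDeltaTheta_normal l).comap _

/-- **G1 (pinning).** If `γ` maps the inverse image of `l·Δ_Θ` into itself (clause (5) of Cor. 2.18 (i)), then every
coefficient automorphism `γ̄_M` compatible with `γ` through `thetaMod_M` (the hypothesis of `ThetaEnvTower.Cor219_iii`)
satisfies `γ̄_M (thetaMod_M g) = thetaMod_M (γ g)` for ALL `g`. [cite: MochizukiEtTh2009, Cor 2.19(iii) p.65] -/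
theorem thetaEnvTower_coeffAut_apply (hC : D.Compat) (hS : D.Sec2Hyps) (M : Es)
    (γ : (C.thetaEnvTower τ hC hS).PiX ≃ₜ* (C.thetaEnvTower τ hC hS).PiX)
    (hγΛ : ∀ g : (C.thetaEnvTower τ hC hS).lDeltaTheta,
      γ (g : (C.thetaEnvTower τ hC hS).PiX) ∈ (C.thetaEnvTower τ hC hS).lDeltaTheta)
    (γμ : (C.thetaEnvTower τ hC hS).mu M ≃* (C.thetaEnvTower τ hC hS).mu M)
    (hcompat : ∀ (g : (C.thetaEnvTower τ hC hS).lDeltaTheta) (hg : γ g ∈ (C.thetaEnvTower τ hC hS).lDeltaTheta),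
      (C.thetaEnvTower τ hC hS).thetaMod M ⟨γ g, hg⟩ = γμ ((C.thetaEnvTower τ hC hS).thetaMod M g))
    (g : (C.thetaEnvTower τ hC hS).lDeltaTheta) :
    γμ ((C.thetaEnvTower τ hC hS).thetaMod M g) = (C.thetaEnvTower τ hC hS).thetaMod M ⟨γ g, hγΛ g⟩ :=
  (hcompat g (hγΛ g)).symm

/-- **G1 (uniqueness).** Under clause (5), any two coefficient automorphisms admitted by the compatibility hypothesis of
`ThetaEnvTower.Cor219_iii` coincide (`(l·Δ_Θ) ↠ μ_M` is onto). [cite: MochizukiEtTh2009, Cor 2.19(iii) p.65] -/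
theorem thetaEnvTower_coeffAut_unique (hC : D.Compat) (hS : D.Sec2Hyps) (M : Es)
    (γ : (C.thetaEnvTower τ hC hS).PiX ≃ₜ* (C.thetaEnvTower τ hC hS).PiX)
    (hγΛ : ∀ g : (C.thetaEnvTower τ hC hS).lDeltaTheta,
      γ (g : (C.thetaEnvTower τ hC hS).PiX) ∈ (C.thetaEnvTower τ hC hS).lDeltaTheta)
    (γμ γμ' : (C.thetaEnvTower τ hC hS).mu M ≃* (C.thetaEnvTower τ hC hS).mu M)
    (hcompat : ∀ (g : (C.thetaEnvTower τ hC hS).lDeltaTheta) (hg : γ g ∈ (C.thetaEnvTower τ hC hS).lDeltaTheta),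
      (C.thetaEnvTower τ hC hS).thetaMod M ⟨γ g, hg⟩ = γμ ((C.thetaEnvTower τ hC hS).thetaMod M g))
    (hcompat' : ∀ (g : (C.thetaEnvTower τ hC hS).lDeltaTheta) (hg : γ g ∈ (C.thetaEnvTower τ hC hS).lDeltaTheta),
      (C.thetaEnvTower τ hC hS).thetaMod M ⟨γ g, hg⟩ = γμ' ((C.thetaEnvTower τ hC hS).thetaMod M g)) :
    γμ = γμ' := by
  apply MulEquiv.ext
  intro m
  obtain ⟨g, rfl⟩ := (C.thetaEnvTower τ hC hS).thetaMod_surjective M m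
  rw [← hcompat g (hγΛ g), ← hcompat' g (hγΛ g)]

/-- **G1′ (equivariance).** Under clause (5), a coefficient automorphism `γ̄_M` admitted by the compatibility hypothesis
intertwines the `G_K`-actions through `γ`: `γ̄_M (χ(aug k) · m) = χ(aug (γ k)) · γ̄_M m` for every `k ∈ Π^tp_X̲̲` — the only
equivariance the transport of cocycles along `γ` uses (no identity `χ ∘ aug ∘ γ = χ ∘ aug` is needed).
[cite: MochizukiEtTh2009, Cor 2.19(iii) p.65] -/
theorem thetaEnvTower_coeffAut_equivariant (hC : D.Compat) (hS : D.Sec2Hyps) (M : Es)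
    (γ : (C.thetaEnvTower τ hC hS).PiX ≃ₜ* (C.thetaEnvTower τ hC hS).PiX)
    (hγΛ : ∀ g : (C.thetaEnvTower τ hC hS).lDeltaTheta,
      γ (g : (C.thetaEnvTower τ hC hS).PiX) ∈ (C.thetaEnvTower τ hC hS).lDeltaTheta)
    (γμ : (C.thetaEnvTower τ hC hS).mu M ≃* (C.thetaEnvTower τ hC hS).mu M)
    (hcompat : ∀ (g : (C.thetaEnvTower τ hC hS).lDeltaTheta) (hg : γ g ∈ (C.thetaEnvTower τ hC hS).lDeltaTheta),
      (C.thetaEnvTower τ hC hS).thetaMod M ⟨γ g, hg⟩ = γμ ((C.thetaEnvTower τ hC hS).thetaMod M g))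
    (k : (C.thetaEnvTower τ hC hS).PiX) (m : (C.thetaEnvTower τ hC hS).mu M) :
    γμ (galMuN p M (D.aug.toMonoidHom (k : D.PiTemp)) m) =
      galMuN p M (D.aug.toMonoidHom ((γ k : (C.thetaEnvTower τ hC hS).PiX) : D.PiTemp)) (γμ m) := by
  haveI := C.thetaEnvTower_lDeltaTheta_normal τ hC hS
  obtain ⟨g, rfl⟩ := (C.thetaEnvTower τ hC hS).thetaMod_surjective M m
  have hkg : k * (g : (C.thetaEnvTower τ hC hS).PiX) * k⁻¹ ∈ (C.thetaEnvTower τ hC hS).lDeltaTheta :=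
    (C.thetaEnvTower_lDeltaTheta_normal τ hC hS).conj_mem _ g.2 _
  rw [← C.thetaEnvTower_thetaMod_conj τ hC hS M k g hkg,
    C.thetaEnvTower_coeffAut_apply τ hC hS M γ hγΛ γμ hcompat ⟨_, hkg⟩,
    C.thetaEnvTower_coeffAut_apply τ hC hS M γ hγΛ γμ hcompat g]
  have hγkg : γ k * (γ (g : (C.thetaEnvTower τ hC hS).PiX)) * (γ k)⁻¹ ∈ (C.thetaEnvTower τ hC hS).lDeltaTheta :=
    (C.thetaEnvTower_lDeltaTheta_normal τ hC hS).conj_mem _ (hγΛ g) _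
  rw [← C.thetaEnvTower_thetaMod_conj τ hC hS M (γ k) ⟨γ g, hγΛ g⟩ hγkg]
  congr 1
  apply Subtype.ext
  change γ (k * (g : (C.thetaEnvTower τ hC hS).PiX) * k⁻¹) = γ k * γ (g : (C.thetaEnvTower τ hC hS).PiX) * (γ k)⁻¹
  rw [map_mul, map_mul, map_inv]

/-! ## §2. The inflation step (roadmap G7): cocycles on `Π^tp_Ÿ̲̲` vanishing on `Δ` come from `G_K` -/

/-- Two elements of `Π^tp_Ÿ̲̲` with the same image in `G_K` give the same value of a mod-`M` cocycle vanishing on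
`Π^tp_Ÿ̲̲ ∩ Ker(aug)`. [cite: MochizukiEtTh2009, Prop 2.2 (iii) p.37] -/
theorem eq_of_aug_eq_of_vanishing (hC : D.Compat) (hS : D.Sec2Hyps) (M : Es)
    (q : (C.thetaEnvTower τ hC hS).PiYdd → (C.thetaEnvTower τ hC hS).mu M)
    (hq : ∀ g h : (C.thetaEnvTower τ hC hS).PiYdd, q (g * h) =
      q g * (C.thetaEnvTower τ hC hS).chi M ((C.thetaEnvTower τ hC hS).aug (g : (C.thetaEnvTower τ hC hS).PiX)) (q h))
    (hvan : ∀ g : (C.thetaEnvTower τ hC hS).PiYdd,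
      (C.thetaEnvTower τ hC hS).aug (g : (C.thetaEnvTower τ hC hS).PiX) = 1 → q g = 1)
    (g g' : (C.thetaEnvTower τ hC hS).PiYdd)
    (hgg' : (C.thetaEnvTower τ hC hS).aug (g : (C.thetaEnvTower τ hC hS).PiX) =
      (C.thetaEnvTower τ hC hS).aug (g' : (C.thetaEnvTower τ hC hS).PiX)) :
    q g = q g' := by
  have hker : (C.thetaEnvTower τ hC hS).aug ((g * g'⁻¹ : (C.thetaEnvTower τ hC hS).PiYdd) :
      (C.thetaEnvTower τ hC hS).PiX) = 1 := by
    rw [Subgroup.coe_mul, Subgroup.coe_inv, map_mul, map_inv, hgg', mul_inv_cancel]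
  have h1 : q (g * g'⁻¹) = 1 := hvan _ hker
  have h2 := hq (g * g'⁻¹) g'
  rw [inv_mul_cancel_right, h1, one_mul, hker, map_one, MulAut.one_apply] at h2
  exact h2

/-- **G7 (inflation through `aug`).** A locally constant `μ_M`-valued function `q` on `Π^tp_Ÿ̲̲` satisfying the mod-`M`
cocycle law `q(gh) = q(g)·χ(aug g)(q(h))` and vanishing on `Π^tp_Ÿ̲̲ ∩ Ker(aug)` factors as `q = c ∘ aug` with `c` a
`G_K`-cocycle (`CycEnvelope.IsEnvCocycle` for `χ`); if moreover `aug|_{Π^tp_Ÿ̲̲}` is an open map then `c ∘ aug` is locally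
constant on all of `Π^tp_X̲̲` — the shape of the family `c = (c_M)_M` in the conclusion of `ThetaEnvTower.Cor219_iii`
("`G_K ≅ Π_X̲̲/Δ_X̲̲`", `Π^tp_Ÿ̲̲ ↠ G_K` = `map_aug_Ydduu`, abc-iut-L2-t8's `lift`). [cite: MochizukiEtTh2009, Prop 2.2 (iii) p.37] -/
theorem exists_envCocycle_of_vanishing (hC : D.Compat) (hS : D.Sec2Hyps) (M : Es)
    (q : (C.thetaEnvTower τ hC hS).PiYdd → (C.thetaEnvTower τ hC hS).mu M)
    (hq : ∀ g h : (C.thetaEnvTower τ hC hS).PiYdd, q (g * h) =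
      q g * (C.thetaEnvTower τ hC hS).chi M ((C.thetaEnvTower τ hC hS).aug (g : (C.thetaEnvTower τ hC hS).PiX)) (q h))
    (hvan : ∀ g : (C.thetaEnvTower τ hC hS).PiYdd,
      (C.thetaEnvTower τ hC hS).aug (g : (C.thetaEnvTower τ hC hS).PiX) = 1 → q g = 1)
    (hlc : IsLocallyConstant q)
    (hopen : IsOpenMap fun g : (C.thetaEnvTower τ hC hS).PiYdd =>
      (C.thetaEnvTower τ hC hS).aug (g : (C.thetaEnvTower τ hC hS).PiX)) :
    ∃ c : (C.thetaEnvTower τ hC hS).G → (C.thetaEnvTower τ hC hS).mu M,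
      CycEnvelope.IsEnvCocycle (MonoidHom.id (C.thetaEnvTower τ hC hS).G) ((C.thetaEnvTower τ hC hS).chi M) c ∧
      IsLocallyConstant (c ∘ (C.thetaEnvTower τ hC hS).aug) ∧
      ∀ g : (C.thetaEnvTower τ hC hS).PiYdd, q g = c ((C.thetaEnvTower τ hC hS).aug (g : (C.thetaEnvTower τ hC hS).PiX)) := by
  -- the chosen lift `G_K → Π^tp_Ÿ̲̲` of abc-iut-L2-t8, in tower currency
  let ι : C.GtpYdduu → (C.thetaEnvTower τ hC hS).PiYdd := fun k =>
    ⟨⟨(k : D.PiTemp), (Subgroup.mem_inf.1 k.2).2⟩, (Subgroup.mem_inf.1 k.2).1⟩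
  have haugι : ∀ γ : (C.thetaEnvTower τ hC hS).G,
      (C.thetaEnvTower τ hC hS).aug ((ι (C.lift γ) : (C.thetaEnvTower τ hC hS).PiYdd) :
        (C.thetaEnvTower τ hC hS).PiX) = γ := by
    intro γ
    apply Subtype.ext
    exact C.aug_lift γ
  refine ⟨fun γ => q (ι (C.lift γ)), fun γ γ' => ?_, ?_, fun g => ?_⟩
  · -- the cocycle law on `G_K`
    change q (ι (C.lift (γ * γ'))) = q (ι (C.lift γ)) * (C.thetaEnvTower τ hC hS).chi M γ (q (ι (C.lift γ')))
    have hprod : (C.thetaEnvTower τ hC hS).aug ((ι (C.lift (γ * γ')) : (C.thetaEnvTower τ hC hS).PiX)) =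
        (C.thetaEnvTower τ hC hS).aug
          (((ι (C.lift γ) * ι (C.lift γ') : (C.thetaEnvTower τ hC hS).PiYdd) : (C.thetaEnvTower τ hC hS).PiX)) := by
      rw [haugι, Subgroup.coe_mul, map_mul, haugι, haugι]
    rw [C.eq_of_aug_eq_of_vanishing τ hC hS M q hq hvan _ _ hprod, hq, haugι]
  · -- `c ∘ aug` is locally constant on `Π^tp_X̲̲`
    refine IsLocallyConstant.iff_isOpen_fiber.2 fun m => ?_
    have hset : (fun x : (C.thetaEnvTower τ hC hS).PiX => q (ι (C.lift ((C.thetaEnvTower τ hC hS).aug x)))) ⁻¹' {m} =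
        (C.thetaEnvTower τ hC hS).aug ⁻¹'
          ((fun g : (C.thetaEnvTower τ hC hS).PiYdd =>
            (C.thetaEnvTower τ hC hS).aug (g : (C.thetaEnvTower τ hC hS).PiX)) '' (q ⁻¹' {m})) := by
      ext x
      simp only [Set.mem_preimage, Set.mem_singleton_iff, Set.mem_image]
      constructor
      · intro hx
        exact ⟨ι (C.lift ((C.thetaEnvTower τ hC hS).aug x)), hx, haugι _⟩
      · rintro ⟨g, hg, hgx⟩
        rw [← hg]
        exact C.eq_of_aug_eq_of_vanishing τ hC hS M q hq hvan _ _ ((haugι _).trans hgx.symm)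
    change IsOpen ((fun x : (C.thetaEnvTower τ hC hS).PiX =>
      q (ι (C.lift ((C.thetaEnvTower τ hC hS).aug x)))) ⁻¹' {m})
    rw [hset]
    refine IsOpen.preimage ?_ (hopen _ ((hlc.isOpen_fiber m)))
    exact (map_continuous D.aug).comp continuous_subtype_val |>.subtype_mk _
  · -- `q = c ∘ aug` on `Π^tp_Ÿ̲̲`
    exact C.eq_of_aug_eq_of_vanishing τ hC hS M q hq hvan _ _ (haugι _).symm


/-! ## §3. The automorphism of `l·Δ_Θ` INDUCED by `γ` (roadmap G2) -/

/-- `Π^tp_X̲̲ ∩ θ⁻¹(l·Δ_Θ) ↠ l·Δ_Θ` is onto (`θ(Π^tp_X̲̲) ∩ Δ_Θ = l·Δ_Θ`, `map_toTheta_Huu`) — a private copy of the statement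
of `DoubleUnderline.toLDelta_surjective` (abc-iut, `Discharge/Sec5Prop55HPprojAtSettingQ`, p445332), re-proved in five lines from
`map_toTheta_Huu` so that this §2 file does not import the §5 Frobenioid closure. [cite: MochizukiEtTh2009, Prop 2.12 (i) p.45] -/
private theorem toLDelta_onto : Function.Surjective C.toLDelta := by
  intro a
  have ha : (a : D.GtpTheta) ∈ C.Huu.map D.toTheta ⊓ D.DeltaTheta := by
    rw [C.map_toTheta_Huu]; exact a.2
  obtain ⟨⟨h, hh, hha⟩, -⟩ := ha
  refine ⟨⟨⟨h, hh⟩, ?_⟩, Subtype.ext ?_⟩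
  · rw [Subgroup.mem_comap, MonoidHom.coe_comp, Function.comp_apply, Subgroup.coe_subtype, hha]
    exact a.2
  · rw [coe_toLDelta]
    exact hha

/-- The kernel of `Π^tp_X̲̲ ∩ θ⁻¹(l·Δ_Θ) ↠ l·Δ_Θ` is (the trace of) `Ker(Π^tp_X̲̲ → (Π^tp_X)^Θ)`.
[cite: MochizukiEtTh2009, Prop 2.12 (i) p.45] -/
theorem toLDelta_eq_one_iff (g : (D.lDeltaTheta l).comap (D.toTheta.comp C.Huu.subtype)) :
    C.toLDelta g = 1 ↔ (g : C.Huu) ∈ (D.toTheta.comp C.Huu.subtype).ker := by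
  rw [MonoidHom.mem_ker, MonoidHom.coe_comp, Function.comp_apply, Subgroup.coe_subtype]
  constructor
  · intro h
    have := congrArg Subtype.val h
    rwa [coe_toLDelta] at this
  · intro h
    exact Subtype.ext (by rw [coe_toLDelta, h]; rfl)

section Tower2

variable {Es : Set ℕ+} (τ : D.CyclotomeTower l Es)

/-- **G2 (the induced automorphism of `l·Δ_Θ`).** An automorphism `γ` of `Π^tp_X̲̲` preserving
`Ker(Π^tp_X̲̲ → (Π^tp_X)^Θ)` and the inverse image of `l·Δ_Θ` (clauses (4), (5) of Cor. 2.18 (i)) INDUCES an automorphism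
`γ̃` of `l·Δ_Θ` itself with `θ(γ g) = γ̃(θ g)` on the inverse image — the `l·Δ_Θ`-level twin of abc-iut-L2-d1's
`RigidData.exists_mulEquiv_thetaMod_comp` (which induces `γ̄_M` on each `μ_M`); every `γ̄_M` of G1 is then `red_M ∘ γ̃`.
[cite: MochizukiEtTh2009, Cor 2.18 (i) p.60] -/
theorem exists_lDeltaAut (hC : D.Compat) (hS : D.Sec2Hyps)
    (γ : (C.thetaEnvTower τ hC hS).PiX ≃* (C.thetaEnvTower τ hC hS).PiX)
    (hK : (D.toTheta.comp C.Huu.subtype).ker.map γ.toMonoidHom = (D.toTheta.comp C.Huu.subtype).ker)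
    (hL : (C.thetaEnvTower τ hC hS).lDeltaTheta.map γ.toMonoidHom = (C.thetaEnvTower τ hC hS).lDeltaTheta) :
    ∃ γΛ : D.lDeltaTheta l ≃* D.lDeltaTheta l,
      ∀ (g : (C.thetaEnvTower τ hC hS).lDeltaTheta) (hg : γ g ∈ (C.thetaEnvTower τ hC hS).lDeltaTheta),
        C.toLDelta ⟨γ g, hg⟩ = γΛ (C.toLDelta g) := by
  -- membership transport along `γ`, `γ⁻¹`
  have memL : ∀ {g : (C.thetaEnvTower τ hC hS).PiX}, g ∈ (C.thetaEnvTower τ hC hS).lDeltaTheta →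
      γ g ∈ (C.thetaEnvTower τ hC hS).lDeltaTheta := fun {g} hg => by
    rw [← hL]; exact ⟨g, hg, rfl⟩
  have memL' : ∀ {g : (C.thetaEnvTower τ hC hS).PiX}, g ∈ (C.thetaEnvTower τ hC hS).lDeltaTheta →
      γ.symm g ∈ (C.thetaEnvTower τ hC hS).lDeltaTheta := fun {g} hg => by
    have hg' : g ∈ (C.thetaEnvTower τ hC hS).lDeltaTheta.map γ.toMonoidHom := by rw [hL]; exact hg
    obtain ⟨g₀, hg₀, hg₀eq⟩ := hg'
    have : γ.symm g = g₀ := by rw [← hg₀eq]; exact γ.symm_apply_apply g₀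
    rw [this]; exact hg₀
  have memK : ∀ {g : (C.thetaEnvTower τ hC hS).PiX}, g ∈ (D.toTheta.comp C.Huu.subtype).ker →
      γ g ∈ (D.toTheta.comp C.Huu.subtype).ker := fun {g} hg => by
    rw [← hK]; exact ⟨g, hg, rfl⟩
  have memK' : ∀ {g : (C.thetaEnvTower τ hC hS).PiX}, g ∈ (D.toTheta.comp C.Huu.subtype).ker →
      γ.symm g ∈ (D.toTheta.comp C.Huu.subtype).ker := fun {g} hg => by
    have hg' : g ∈ (D.toTheta.comp C.Huu.subtype).ker.map γ.toMonoidHom := by rw [hK]; exact hg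
    obtain ⟨g₀, hg₀, hg₀eq⟩ := hg'
    have : γ.symm g = g₀ := by rw [← hg₀eq]; exact γ.symm_apply_apply g₀
    rw [this]; exact hg₀
  -- the restrictions of `γ`, `γ⁻¹` to the inverse image of `l·Δ_Θ`
  let ρ : (C.thetaEnvTower τ hC hS).lDeltaTheta →* (C.thetaEnvTower τ hC hS).lDeltaTheta :=
    (γ.toMonoidHom.comp (C.thetaEnvTower τ hC hS).lDeltaTheta.subtype).codRestrict _ fun g => memL g.2
  let ρ' : (C.thetaEnvTower τ hC hS).lDeltaTheta →* (C.thetaEnvTower τ hC hS).lDeltaTheta :=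
    (γ.symm.toMonoidHom.comp (C.thetaEnvTower τ hC hS).lDeltaTheta.subtype).codRestrict _ fun g => memL' g.2
  have hρ : ∀ g, ((ρ g : (C.thetaEnvTower τ hC hS).lDeltaTheta) : (C.thetaEnvTower τ hC hS).PiX) = γ g :=
    fun g => rfl
  have hρ' : ∀ g, ((ρ' g : (C.thetaEnvTower τ hC hS).lDeltaTheta) : (C.thetaEnvTower τ hC hS).PiX) = γ.symm g :=
    fun g => rfl
  have hρρ' : ∀ g, ρ (ρ' g) = g := fun g => Subtype.ext (by rw [hρ, hρ']; exact γ.apply_symm_apply _)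
  have hρ'ρ : ∀ g, ρ' (ρ g) = g := fun g => Subtype.ext (by rw [hρ', hρ]; exact γ.symm_apply_apply _)
  -- `toLDelta ∘ ρ` kills `Ker toLDelta` (and likewise for `ρ'`)
  have hker : C.toLDelta.ker ≤ (C.toLDelta.comp ρ).ker := fun g hg => by
    rw [MonoidHom.mem_ker] at hg ⊢
    rw [MonoidHom.comp_apply, C.toLDelta_eq_one_iff]
    exact memK ((C.toLDelta_eq_one_iff g).1 hg)
  have hker' : C.toLDelta.ker ≤ (C.toLDelta.comp ρ').ker := fun g hg => by
    rw [MonoidHom.mem_ker] at hg ⊢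
    rw [MonoidHom.comp_apply, C.toLDelta_eq_one_iff]
    exact memK' ((C.toLDelta_eq_one_iff g).1 hg)
  let φ : D.lDeltaTheta l →* D.lDeltaTheta l := C.toLDelta.liftOfSurjective C.toLDelta_onto ⟨_, hker⟩
  let φ' : D.lDeltaTheta l →* D.lDeltaTheta l := C.toLDelta.liftOfSurjective C.toLDelta_onto ⟨_, hker'⟩
  have hφ : ∀ g, φ (C.toLDelta g) = C.toLDelta (ρ g) := fun g =>
    C.toLDelta.liftOfRightInverse_comp_apply _ _ ⟨_, hker⟩ g
  have hφ' : ∀ g, φ' (C.toLDelta g) = C.toLDelta (ρ' g) := fun g =>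
    C.toLDelta.liftOfRightInverse_comp_apply _ _ ⟨_, hker'⟩ g
  have h1 : φ'.comp φ = MonoidHom.id _ := by
    refine MonoidHom.ext fun m => ?_
    obtain ⟨g, rfl⟩ := C.toLDelta_onto m
    rw [MonoidHom.comp_apply, hφ, hφ', hρ'ρ, MonoidHom.id_apply]
  have h2 : φ.comp φ' = MonoidHom.id _ := by
    refine MonoidHom.ext fun m => ?_
    obtain ⟨g, rfl⟩ := C.toLDelta_onto m
    rw [MonoidHom.comp_apply, hφ', hφ, hρρ', MonoidHom.id_apply]
  refine ⟨MonoidHom.toMulEquiv φ φ' h1 h2, fun g hg => ?_⟩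
  change C.toLDelta ⟨γ g, hg⟩ = φ (C.toLDelta g)
  rw [hφ]
  rfl

/-- **G2′ (equivariance of `γ̃`).** The induced automorphism of `l·Δ_Θ` intertwines the conjugation actions of
`Π^tp_X̲̲` through `γ`: `γ̃(θk · a · θk⁻¹) = θ(γ k) · γ̃(a) · θ(γ k)⁻¹`. [cite: MochizukiEtTh2009, Cor 2.18 (i) p.60] -/
theorem lDeltaAut_conj (hC : D.Compat) (hS : D.Sec2Hyps)
    (γ : (C.thetaEnvTower τ hC hS).PiX ≃* (C.thetaEnvTower τ hC hS).PiX)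
    (hL : (C.thetaEnvTower τ hC hS).lDeltaTheta.map γ.toMonoidHom = (C.thetaEnvTower τ hC hS).lDeltaTheta)
    (γΛ : D.lDeltaTheta l ≃* D.lDeltaTheta l)
    (hγΛ : ∀ (g : (C.thetaEnvTower τ hC hS).lDeltaTheta) (hg : γ g ∈ (C.thetaEnvTower τ hC hS).lDeltaTheta),
      C.toLDelta ⟨γ g, hg⟩ = γΛ (C.toLDelta g))
    (k : (C.thetaEnvTower τ hC hS).PiX) (a : D.lDeltaTheta l) :
    (γΛ ⟨D.toTheta (k : D.PiTemp) * a * (D.toTheta (k : D.PiTemp))⁻¹, (D.lDeltaTheta_normal l).conj_mem _ a.2 _⟩ :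
        D.GtpTheta) =
      D.toTheta ((γ k : (C.thetaEnvTower τ hC hS).PiX) : D.PiTemp) * (γΛ a : D.GtpTheta) *
        (D.toTheta ((γ k : (C.thetaEnvTower τ hC hS).PiX) : D.PiTemp))⁻¹ := by
  haveI := C.thetaEnvTower_lDeltaTheta_normal τ hC hS
  have memL : ∀ {g : (C.thetaEnvTower τ hC hS).PiX}, g ∈ (C.thetaEnvTower τ hC hS).lDeltaTheta →
      γ g ∈ (C.thetaEnvTower τ hC hS).lDeltaTheta := fun {g} hg => by
    rw [← hL]; exact ⟨g, hg, rfl⟩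
  obtain ⟨g, rfl⟩ := C.toLDelta_onto a
  have hkg : k * (g : (C.thetaEnvTower τ hC hS).PiX) * k⁻¹ ∈ (C.thetaEnvTower τ hC hS).lDeltaTheta :=
    (C.thetaEnvTower_lDeltaTheta_normal τ hC hS).conj_mem _ g.2 _
  have hconj : (⟨D.toTheta (k : D.PiTemp) * (C.toLDelta g : D.GtpTheta) * (D.toTheta (k : D.PiTemp))⁻¹,
      (D.lDeltaTheta_normal l).conj_mem _ (C.toLDelta g).2 _⟩ : D.lDeltaTheta l) = C.toLDelta ⟨_, hkg⟩ := by
    apply Subtype.ext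
    simp only [coe_toLDelta, Subgroup.coe_mul, Subgroup.coe_inv, map_mul, map_inv]
  rw [hconj, ← hγΛ ⟨_, hkg⟩ (memL hkg), ← hγΛ g (memL g.2), coe_toLDelta, coe_toLDelta]
  change D.toTheta ((γ (k * (g : (C.thetaEnvTower τ hC hS).PiX) * k⁻¹) : (C.thetaEnvTower τ hC hS).PiX) : D.PiTemp) = _
  simp only [map_mul, map_inv, Subgroup.coe_mul, Subgroup.coe_inv]

end Tower2

end ThetaSetting.EtaleThetaData.DoubleUnderline

end Literature.AnabelianGeometry.EtaleTheta

end
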